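import Mathlib
import Literature.MathematicalPhysics.QuantumLattice.WilsonDiracAP
import Summits.QuantumFields.QCD.Theorems.QuarksAsStableActionWilsonQuarkStabilityStubFreeTwistedFourier

/-!
# The free antiperiodic Wilson determinant in closed form
(helper for crux stmt-QuantumFields-9734, line `Sketch`, stub `stub_freeDetFormula`)

For the FREE `r = 1` Wilson–Dirac operator on the four-torus `(ℤ/L)⁴` (colour `Fin 3`, spin `Fin 4`,
bare mass `m`) with fermionic boundary conditions ANTIPERIODIC in all four directions — the trivial
`U(3)` field sign-twisted on the links leaving the last slice `x_μ = L - 1` in their own direction —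
`‖det D_AP[1, m]‖² = ∏_k h_m(k)^12`, `h_m(k) = (m + Σ_μ (1 − cos θ_μ))² + Σ_μ sin² θ_μ`,
`θ_μ = (2 k_μ + 1)π/L`.  Proof.  (1) SEAM ↔ PHASE: with `ω = e^{iπ/L}·1 ∈ U(3)` and the gauge function
`s x := ω ^ (Σ_ν val x_ν)`, the gauge transform of the CONSTANT field `ω` by `s` is the seam field (off
the seam the exponent grows by one, across it it drops by `L - 1`, and `ω^L = e^{iπ} = -1`), so by gauge
invariance of the fermion determinant (`fermionDet_wilsonDirac_gaugeTransform`)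
`det D_AP[1, m] = det D[ω, m]`.  (2) FOURIER: the tree's plane-wave diagonalisation of the free operator
of a constant central phase (`wilsonDirac_twist_mul_planeP`: `D P = Q` with the unitary plane-wave matrix
`P = F ⊗ 1` and colour–spin symbol `M(k) = (m + Σ(1 − cos φ_μ))·1 + iΣ sin φ_μ γ_μ` at the SHIFTED
angles `φ_μ = 2π k_μ/L + π/L = θ_μ`), the Clifford identity `M(k)ᴴ M(k) = h_m(k)·1`
(`clifford_conjTranspose_mul_self`) and character orthonormality (`symQ_conjTranspose_mul_self_of`,
`planeP_conjTranspose_mul_self`) give `(DP)ᴴ(DP) = diagonal (h_m ∘ fst)`, `Pᴴ P = 1`; taking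
determinants, `‖det D‖² = ∏_{(k,a,α)} h_m(k) = ∏_k h_m(k)^12`.  References: Montvay–Münster,
*Quantum Fields on a Lattice* §4.2.4 (4.112)–(4.119) (antiperiodic Wilson fermions in momentum space);
folklore.  Pure theorem file (no definitions).
-/

noncomputable section

open scoped BigOperators Classical Matrix ComplexConjugate
open Finset
open Literature.MathematicalPhysics.QuantumLattice Literature.MathematicalPhysics.QuantumFieldTheory
  Literature.Probability.LatticeModels

namespace Summit.QuantumFields.QCD.Cruxes.CriticalLineDiamagnetism.ChessboardCellGain

open scoped Kronecker
open Complex (I)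
open Summit.QuantumFields.QCD.Theorems.HeatSlicedQuarks.FreeKernel
open Summit.QuantumFields.QCD.Cruxes.TipNoBinding.PositivityNoLeakSpread
open Summit.QuantumFields.QCD.Cruxes.WilsonQuarkStability.FreeTangentLandauChessboard

namespace FreeDetFormula

/-! ### Determinants from a unitary diagonalisation -/

/-- If `Pᴴ P = 1` and `(A P)ᴴ (A P) = diagonal d` with a real `d`, then `‖det A‖² = ∏ d`
(`det Mᴴ = conj (det M)`, `conj z · z = ‖z‖²`, `‖det P‖² = 1`). -/
theorem norm_sq_det_of_diag {ι : Type*} [Fintype ι] [DecidableEq ι] (P A : Matrix ι ι ℂ)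
    (d : ι → ℝ) (hP : Pᴴ * P = 1)
    (hd : (A * P)ᴴ * (A * P) = Matrix.diagonal fun q => ((d q : ℝ) : ℂ)) :
    ‖A.det‖ ^ 2 = ∏ q, d q := by
  have hPdet : conj P.det * P.det = 1 := by
    have h := congrArg Matrix.det hP
    rwa [Matrix.det_mul, Matrix.det_conjTranspose, Matrix.det_one, Complex.star_def] at h
  have h := congrArg Matrix.det hd
  rw [Matrix.det_mul, Matrix.det_conjTranspose, Matrix.det_diagonal, Matrix.det_mul, Complex.star_def,
    map_mul] at h
  have h2 : conj A.det * A.det = ∏ q, ((d q : ℝ) : ℂ) := by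
    rw [← h]
    calc conj A.det * A.det = conj A.det * A.det * (conj P.det * P.det) := by rw [hPdet, mul_one]
      _ = conj A.det * conj P.det * (A.det * P.det) := by ring
  rw [Complex.conj_mul'] at h2
  exact_mod_cast h2

variable {L : ℕ} [NeZero L]

/-- **`‖det A‖²` from a plane-wave diagonalisation.**  If `A P = Q` for the unitary plane-wave matrix
`P = F ⊗ 1`, `F(x,k) = L⁻² χ_k(x)`, with `Q(p,q) = F(p.1,q.1) · (1 ⊗ N(q.1))(p.2,q.2)` and normalised
spin blocks `N(k)ᴴ N(k) = d(k)·1` (`d` real), then `‖det A‖² = ∏_k d(k)^12`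
(`12 = |Fin 3 × Fin 4|` colour–spin components per momentum). -/
theorem norm_sq_det_of_planeWave (N : TorusSite 4 L → Matrix (Fin 4) (Fin 4) ℂ)
    (d : TorusSite 4 L → ℝ)
    (hN : ∀ k, (N k)ᴴ * N k = ((d k : ℝ) : ℂ) • (1 : Matrix (Fin 4) (Fin 4) ℂ))
    (A : Matrix (TorusSite 4 L × Fin 3 × Fin 4) (TorusSite 4 L × Fin 3 × Fin 4) ℂ)
    (hA : A * ((Matrix.of fun x k : TorusSite 4 L => ((L : ℂ) ^ 2)⁻¹ * torusChar k x) ⊗ₖ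
        (1 : Matrix (Fin 3 × Fin 4) (Fin 3 × Fin 4) ℂ)) =
      Matrix.of fun p q : TorusSite 4 L × Fin 3 × Fin 4 =>
        (Matrix.of fun x k : TorusSite 4 L => ((L : ℂ) ^ 2)⁻¹ * torusChar k x) p.1 q.1 *
          ((1 : Matrix (Fin 3) (Fin 3) ℂ) ⊗ₖ N q.1) p.2 q.2) :
    ‖A.det‖ ^ 2 = ∏ k, d k ^ 12 := by
  have hd : (A * ((Matrix.of fun x k : TorusSite 4 L => ((L : ℂ) ^ 2)⁻¹ * torusChar k x) ⊗ₖ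
        (1 : Matrix (Fin 3 × Fin 4) (Fin 3 × Fin 4) ℂ)))ᴴ *
      (A * ((Matrix.of fun x k : TorusSite 4 L => ((L : ℂ) ^ 2)⁻¹ * torusChar k x) ⊗ₖ
        (1 : Matrix (Fin 3 × Fin 4) (Fin 3 × Fin 4) ℂ))) =
      Matrix.diagonal fun q : TorusSite 4 L × Fin 3 × Fin 4 => ((d q.1 : ℝ) : ℂ) := by
    rw [hA]; exact symQ_conjTranspose_mul_self_of N d hN
  rw [norm_sq_det_of_diag _ A (fun q => d q.1) planeP_conjTranspose_mul_self hd,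
    Fintype.prod_prod_type]
  refine Finset.prod_congr rfl fun k _ => ?_
  simp only [Finset.prod_const, Finset.card_univ, Fintype.card_prod, Fintype.card_fin, Nat.reduceMul]

/-! ### Seam ↔ phase: the antiperiodic seam is a gauge transform of the constant phase `e^{iπ/L}` -/

/-- The constant phase matrix `e^{iπ/L}·1` is unitary. -/
theorem phase_mem_unitaryGroup (L : ℕ) :
    Complex.exp (↑(Real.pi / L) * I) • (1 : Matrix (Fin 3) (Fin 3) ℂ) ∈
      Matrix.unitaryGroup (Fin 3) ℂ := by
  refine Unitary.smul_mem_of_mem ?_ (one_mem _)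
  rw [Unitary.mem_iff, Complex.star_def, Complex.conj_mul', Complex.mul_conj',
    Complex.norm_exp_ofReal_mul_I]
  simp

/-- `ω ^ L = -1` for `ω = e^{iπ/L}·1`: `(e^{iπ/L})^L = e^{iπ} = -1`. -/
theorem phase_pow {ω : Matrix.unitaryGroup (Fin 3) ℂ}
    (hω : (ω : Matrix (Fin 3) (Fin 3) ℂ) =
      Complex.exp (↑(Real.pi / L) * I) • (1 : Matrix (Fin 3) (Fin 3) ℂ)) :
    ω ^ L = -1 := by
  apply Subtype.ext
  have hL : (L : ℂ) ≠ 0 := Nat.cast_ne_zero.2 (NeZero.ne L)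
  have harg : (L : ℂ) * (↑(Real.pi / L) * I) = Real.pi * I := by
    rw [Complex.ofReal_div, Complex.ofReal_natCast]
    field_simp
  rw [SubmonoidClass.coe_pow, hω, smul_pow, one_pow, ← Complex.exp_nat_mul, harg,
    Complex.exp_pi_mul_I, Unitary.coe_neg, OneMemClass.coe_one, neg_smul, one_smul]

/-- Seam convention: on `ZMod L` (`L ≠ 0`), `x.val + 1 = L ↔ x = -1`. -/
theorem val_add_one_eq_iff (x : ZMod L) : x.val + 1 = L ↔ x = -1 := by
  obtain ⟨n, hn⟩ : ∃ n, L = n + 1 := Nat.exists_eq_succ_of_ne_zero (NeZero.ne L)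
  subst hn
  constructor
  · intro h
    have h1 : ((x.val + 1 : ℕ) : ZMod (n + 1)) = 0 := by
      rw [h]
      exact ZMod.natCast_self _
    rw [Nat.cast_add, Nat.cast_one, ZMod.natCast_zmod_val] at h1
    exact eq_neg_of_add_eq_zero_left h1
  · rintro rfl
    rw [ZMod.val_neg_one]

/-- `val (-1) = L - 1` in `ZMod L`, `L ≥ 1`. -/
theorem zmod_val_neg_one : (-1 : ZMod L).val = L - 1 := by
  obtain ⟨n, rfl⟩ := Nat.exists_eq_succ_of_ne_zero (NeZero.ne L)
  rw [ZMod.val_neg_one, Nat.succ_sub_one]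

/-- `val (a + 1) = val a + 1` unless `a = -1`. -/
theorem zmod_val_add_one {a : ZMod L} (ha : a ≠ -1) : (a + 1).val = a.val + 1 := by
  have hL1 : L ≠ 1 := by rintro rfl; exact ha (Subsingleton.elim _ _)
  have h1 : (1 : ZMod L).val = 1 := ZMod.val_one'' hL1
  have hlt : a.val + 1 < L := by
    by_contra hge
    apply ha
    have hval : a.val = L - 1 := by have := ZMod.val_lt a; omega
    have h0 : a + 1 = 0 := by
      rw [← ZMod.val_eq_zero, ZMod.val_add, h1, hval, Nat.sub_add_cancel NeZero.one_le,
        Nat.mod_self]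
    exact eq_neg_of_add_eq_zero_left h0
  rw [ZMod.val_add_of_lt (by rwa [h1]), h1]

omit [NeZero L] in
/-- `(x + μ̂)_μ = x_μ + 1`. -/
theorem shift_apply_self (x : Site 4 L) (μ : Fin 4) : Site.shift x μ μ = x μ + 1 := by
  simp [Literature.MathematicalPhysics.QuantumFieldTheory.Site.shift]

omit [NeZero L] in
/-- `(x + μ̂)_ν = x_ν` for `ν ≠ μ`. -/
theorem shift_apply_of_ne (x : Site 4 L) {μ ν : Fin 4} (h : ν ≠ μ) : Site.shift x μ ν = x ν := by
  simp [Literature.MathematicalPhysics.QuantumFieldTheory.Site.shift, Pi.single_eq_of_ne h]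

/-- **Seam ↔ phase.**  With `s x := ω ^ (Σ_ν val x_ν)`, `ω = e^{iπ/L}·1`, the gauge transform of the
constant field `ω` by `s` is the antiperiodic seam field: `+1` off the seam (the exponent grows by one
along the link, `ω^{n+1} (ω^{n+1})⁻¹ = 1`), `-1` on the seam `val x_μ + 1 = L` (the exponent drops by
`L - 1` and `ω^L = -1`). -/
theorem gaugeTransform_phase_eq_seam {ω : Matrix.unitaryGroup (Fin 3) ℂ}
    (hω : (ω : Matrix (Fin 3) (Fin 3) ℂ) =
      Complex.exp (↑(Real.pi / L) * I) • (1 : Matrix (Fin 3) (Fin 3) ℂ)) :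
    gaugeTransform (fun x : Site 4 L => ω ^ (∑ ν, (x ν).val)) (fun _ : Edge 4 L => ω) =
      fun e : Edge 4 L => if (e.1 e.2).val + 1 = L then (-1 : Matrix.unitaryGroup (Fin 3) ℂ) else 1 := by
  funext ⟨x, μ⟩
  simp only [gaugeTransform]
  have hx : ∑ ν, (x ν).val = (x μ).val + ∑ ν ∈ Finset.univ.erase μ, (x ν).val :=
    (Finset.add_sum_erase _ _ (Finset.mem_univ μ)).symm
  have hxs : ∑ ν, (Site.shift x μ ν).val = (x μ + 1).val + ∑ ν ∈ Finset.univ.erase μ, (x ν).val := by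
    rw [← Finset.add_sum_erase _ _ (Finset.mem_univ μ), shift_apply_self]
    congr 1
    exact Finset.sum_congr rfl fun ν hν => by rw [shift_apply_of_ne x (Finset.ne_of_mem_erase hν)]
  rw [hx, hxs, ← pow_succ]
  set n := ∑ ν ∈ Finset.univ.erase μ, (x ν).val with hn
  by_cases h : (x μ).val + 1 = L
  · have h' : x μ = -1 := (val_add_one_eq_iff _).1 h
    have hL1 : 1 ≤ L := NeZero.one_le
    rw [if_pos h, h', neg_add_cancel, ZMod.val_zero, zero_add, zmod_val_neg_one,
      show L - 1 + n + 1 = L + n by omega, pow_add, mul_inv_cancel_right, phase_pow hω]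
  · have h' : x μ ≠ -1 := fun h'' => h ((val_add_one_eq_iff _).2 h'')
    rw [if_neg h, zmod_val_add_one h', add_right_comm (x μ).val n 1, mul_inv_cancel]

/-- **Seam ↔ phase for the free determinant**: `det D_AP[1, m] = det D[ω, m]`, `ω = e^{iπ/L}·1`
(gauge invariance of the Wilson fermion determinant, `fermionDet_wilsonDirac_gaugeTransform`). -/
theorem det_seam_eq_det_phase (m : ℝ) {ω : Matrix.unitaryGroup (Fin 3) ℂ}
    (hω : (ω : Matrix (Fin 3) (Fin 3) ℂ) =
      Complex.exp (↑(Real.pi / L) * I) • (1 : Matrix (Fin 3) (Fin 3) ℂ)) :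
    (wilsonDirac (unitaryFundamentalRep (Fin 3) ℂ)
        (fun e : Edge 4 L => if (e.1 e.2).val + 1 = L then (-1 : Matrix.unitaryGroup (Fin 3) ℂ) else 1)
        m 1).det =
      (wilsonDirac (unitaryFundamentalRep (Fin 3) ℂ) (fun _ : Edge 4 L => ω) m 1).det := by
  have h := fermionDet_wilsonDirac_gaugeTransform (unitaryFundamentalRep (Fin 3) ℂ)
    (fun x : Site 4 L => ω ^ (∑ ν, (x ν).val)) (fun _ : Edge 4 L => ω) m 1
  rw [gaugeTransform_phase_eq_seam hω] at h
  exact h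

end FreeDetFormula

open FreeDetFormula

/-- **The free antiperiodic Wilson determinant in closed form** (stub `stub_freeDetFormula`):
for the trivial `U(3)` field with the antiperiodic seam (sign `-1` on the links leaving the slice
`val x_μ = L - 1` in direction `μ`, all four directions), bare mass `m`, `r = 1`,
`‖det D_AP[1, m]‖² = ∏_k ((m + Σ_μ (1 − cos θ_μ))² + Σ_μ sin² θ_μ)^12`, `θ_μ = (2 val k_μ + 1)π/L`
(seam ↔ constant phase `e^{iπ/L}` by a gauge transformation, then plane-wave diagonalisation). -/
theorem stub_freeDetFormula :
    ∀ (L : ℕ) [NeZero L] (m : ℝ),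
    let dAP : GaugeConfig 4 L (Matrix.unitaryGroup (Fin 3) ℂ) → ℝ → ℂ := fun V m =>
      (wilsonDirac (unitaryFundamentalRep (Fin 3) ℂ)
        (fun e => if (e.1 e.2).val + 1 = L then -V e else V e) m 1).det;
    ‖dAP 1 m‖ ^ 2 =
      ∏ k : Site 4 L,
        ((m + ∑ μ : Fin 4, (1 - Real.cos ((2 * ((k μ).val : ℝ) + 1) * Real.pi / L))) ^ 2 +
            ∑ μ : Fin 4, Real.sin ((2 * ((k μ).val : ℝ) + 1) * Real.pi / L) ^ 2) ^ 12 := by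
  intro L _ m
  simp only [Pi.one_apply]
  set ω : Matrix.unitaryGroup (Fin 3) ℂ := ⟨_, phase_mem_unitaryGroup L⟩ with hωdef
  have hω : (ω : Matrix (Fin 3) (Fin 3) ℂ) =
      Complex.exp (↑(Real.pi / L) * I) • (1 : Matrix (Fin 3) (Fin 3) ℂ) := rfl
  have hN : ∀ k : TorusSite 4 L,
      ((((m + ∑ μ, (1 - Real.cos (2 * Real.pi * ((k μ).val : ℝ) / L + Real.pi / L))) : ℝ) : ℂ) •
            (1 : Matrix (Fin 4) (Fin 4) ℂ) +
          I • ∑ μ, ((Real.sin (2 * Real.pi * ((k μ).val : ℝ) / L + Real.pi / L) : ℝ) : ℂ) •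
            euclideanGamma μ)ᴴ *
        ((((m + ∑ μ, (1 - Real.cos (2 * Real.pi * ((k μ).val : ℝ) / L + Real.pi / L))) : ℝ) : ℂ) •
            (1 : Matrix (Fin 4) (Fin 4) ℂ) +
          I • ∑ μ, ((Real.sin (2 * Real.pi * ((k μ).val : ℝ) / L + Real.pi / L) : ℝ) : ℂ) •
            euclideanGamma μ) =
      (((m + ∑ μ, (1 - Real.cos (2 * Real.pi * ((k μ).val : ℝ) / L + Real.pi / L))) ^ 2 +
          ∑ μ, Real.sin (2 * Real.pi * ((k μ).val : ℝ) / L + Real.pi / L) ^ 2 : ℝ) : ℂ) •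
        (1 : Matrix (Fin 4) (Fin 4) ℂ) :=
    fun k => clifford_conjTranspose_mul_self _ _
  have hA := wilsonDirac_twist_mul_planeP (L := L) (Real.pi / L) m ω hω
  have hθ : ∀ v : ℝ, 2 * Real.pi * v / L + Real.pi / L = (2 * v + 1) * Real.pi / L := fun v => by ring
  rw [det_seam_eq_det_phase m hω, norm_sq_det_of_planeWave _ _ hN _ hA]
  refine Finset.prod_congr rfl fun k _ => ?_
  simp only [hθ]

end Summit.QuantumFields.QCD.Cruxes.CriticalLineDiamagnetism.ChessboardCellGain

end
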